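import Mathlib
import Summits.Ventures.PercRepro2.Defs

/-!
# The finite LAYER CAKE of the pendant sign method (blind cell PercRepro2, night-2 g4;
proofs/NIGHT2-DARC.md §24)

`S′ = Σ_N μ T + Σ_{Z ∈ 𝒰} μ_Z ρ_Z T̂_Z` with `ρ` monotone and `0 ≤ ρ ≤ 1` is nonnegative as soon
as EVERY up-set `𝒰′ ⊆ 𝒰` has a nonnegative block `G(N ∪ 𝒰′) = Σ_N μT + Σ_{𝒰′} μ T̂ ≥ 0`
(`upset_layer_nonneg`, in the abstract form `0 ≤ λ·b + Σ_{Z ∈ I} τ_Z a_Z` from `0 ≤ b + Σ_{U} a`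
for all up-sets `U` of `I`): induction on `I`, removing a trace `Z₀` of minimal weight that is
minimal for `⊆` among those — `λb + Σ τ a = (λ − τ_{Z₀}) b + τ_{Z₀}(b + Σ_I a) + Σ_{I ∖ Z₀} (τ − τ_{Z₀}) a`
and the last sum is the same statement on the smaller family.  This replaces the explicit Abel
decompositions of CoinTwoStarAbstract / CoinPathStarAbstract / CoinTwoChainsAbstract by the list
of the up-sets' blocks; for a head whose every pivotal up-set is good no regime hypothesis remains.
-/

namespace Summit.Ventures.PercRepro2.Coin

section LayerCake

open Classical

variable {V : Type*} [DecidableEq V] {R : Type*} [Field R] [LinearOrder R] [IsStrictOrderedRing R]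

/-- **The finite layer cake.** If `0 ≤ b + Σ_U a` for every up-set `U` of `I`, then
`0 ≤ λ·b + Σ_I τ a` for every `λ ≥ 0` and every monotone `τ` with `0 ≤ τ ≤ λ` on `I`. -/
theorem upset_layer_nonneg (I : Finset (Finset V)) (a : Finset V → R) (b : R)
    (hU : ∀ U : Finset (Finset V), U ⊆ I → (∀ Z ∈ U, ∀ Z' ∈ I, Z ⊆ Z' → Z' ∈ U) →
      0 ≤ b + ∑ Z ∈ U, a Z) :
    ∀ (lam : R) (τ : Finset V → R), 0 ≤ lam → (∀ Z ∈ I, 0 ≤ τ Z) → (∀ Z ∈ I, τ Z ≤ lam) →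
      (∀ Z ∈ I, ∀ Z' ∈ I, Z ⊆ Z' → τ Z ≤ τ Z') →
      0 ≤ lam * b + ∑ Z ∈ I, τ Z * a Z := by
  induction I using Finset.strongInduction with
  | H I ih =>
  intro lam τ hlam hτ0 hτlam hmono
  have hb : 0 ≤ b := by
    have h := hU ∅ (Finset.empty_subset _) (fun Z hZ => absurd hZ (Finset.notMem_empty Z))
    simpa using h
  rcases Finset.eq_empty_or_nonempty I with hI | hI
  · rw [hI, Finset.sum_empty, add_zero]
    exact mul_nonneg hlam hb
  -- a trace of minimal weight, minimal for `⊆` among those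
  obtain ⟨Z₁, hZ₁I, hZ₁min⟩ := Finset.exists_min_image I τ hI
  set J := I.filter (fun Z => τ Z = τ Z₁) with hJdef
  have hJne : J.Nonempty := ⟨Z₁, Finset.mem_filter.mpr ⟨hZ₁I, rfl⟩⟩
  obtain ⟨Z₀, hZ₀J, hZ₀min⟩ := Finset.exists_min_image J (fun Z => Z.card) hJne
  have hZ₀I : Z₀ ∈ I := (Finset.mem_filter.mp hZ₀J).1
  have hτZ₀ : τ Z₀ = τ Z₁ := (Finset.mem_filter.mp hZ₀J).2
  have hs0 : ∀ Z ∈ I, τ Z₀ ≤ τ Z := fun Z hZ => hτZ₀ ▸ hZ₁min Z hZ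
  -- `Z₀` is minimal in `I` for `⊆`
  have hZ₀minimal : ∀ Z ∈ I, Z ⊆ Z₀ → Z = Z₀ := by
    intro Z hZ hZZ₀
    by_contra hne
    have hlt : Z ⊂ Z₀ := Finset.ssubset_iff_subset_ne.mpr ⟨hZZ₀, hne⟩
    have hτZ : τ Z = τ Z₁ := le_antisymm (hτZ₀ ▸ hmono Z hZ Z₀ hZ₀I hZZ₀) (hZ₁min Z hZ)
    have hZJ : Z ∈ J := Finset.mem_filter.mpr ⟨hZ, hτZ⟩
    have := hZ₀min Z hZJ
    exact absurd this (not_le.mpr (Finset.card_lt_card hlt))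
  set I' := I.erase Z₀ with hI'def
  have hI'sub : I' ⊂ I := Finset.erase_ssubset hZ₀I
  have hI'I : I' ⊆ I := Finset.erase_subset _ _
  -- the induction hypothesis on `I'` with `λ' = λ − τ Z₀`, `τ' = τ − τ Z₀`
  have hU' : ∀ U : Finset (Finset V), U ⊆ I' → (∀ Z ∈ U, ∀ Z' ∈ I', Z ⊆ Z' → Z' ∈ U) →
      0 ≤ b + ∑ Z ∈ U, a Z := by
    intro U hUI' hUup
    refine hU U (hUI'.trans hI'I) ?_
    intro Z hZU Z' hZ'I hZZ'
    by_cases hZ' : Z' = Z₀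
    · exfalso
      have hZI' : Z ∈ I' := hUI' hZU
      have hZne : Z ≠ Z₀ := Finset.ne_of_mem_erase hZI'
      exact hZne (hZ₀minimal Z (hI'I hZI') (hZ' ▸ hZZ'))
    · exact hUup Z hZU Z' (Finset.mem_erase.mpr ⟨hZ', hZ'I⟩) hZZ'
  have hIH := ih I' hI'sub hU' (lam - τ Z₀) (fun Z => τ Z - τ Z₀)
    (by linarith [hτlam Z₀ hZ₀I])
    (fun Z hZ => by linarith [hs0 Z (hI'I hZ)])
    (fun Z hZ => by linarith [hτlam Z (hI'I hZ)])
    (fun Z hZ Z' hZ' h => by linarith [hmono Z (hI'I hZ) Z' (hI'I hZ') h])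
  -- the whole family is an up-set of itself
  have hall := hU I (subset_refl _) (fun _ _ _ hZ' _ => hZ')
  have hs : 0 ≤ τ Z₀ := hτ0 Z₀ hZ₀I
  -- assemble
  have e1 : ∑ Z ∈ I, τ Z * a Z = τ Z₀ * a Z₀ + ∑ Z ∈ I', τ Z * a Z :=
    (Finset.add_sum_erase I (fun Z => τ Z * a Z) hZ₀I).symm
  have e2 : ∑ Z ∈ I, a Z = a Z₀ + ∑ Z ∈ I', a Z :=
    (Finset.add_sum_erase I a hZ₀I).symm
  have e3 : ∑ Z ∈ I', (τ Z - τ Z₀) * a Z = ∑ Z ∈ I', τ Z * a Z - τ Z₀ * ∑ Z ∈ I', a Z := by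
    rw [Finset.mul_sum, ← Finset.sum_sub_distrib]
    exact Finset.sum_congr rfl fun Z _ => by ring
  rw [e3] at hIH
  rw [e2] at hall
  rw [e1]
  nlinarith [mul_nonneg hs hall]

end LayerCake

end Summit.Ventures.PercRepro2.Coin
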